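import Literature.NumberTheory.EllipticCurves.TateModuleTransvectionCriterionProofs
import Literature.NumberTheory.EllipticCurves.LeadingTermPPartRankLeOne
import Literature.NumberTheory.EllipticCurves.CyclotomicIwasawaMainTheoremIrreducible
import Literature.NumberTheory.EllipticCurves.Isogeny
import Literature.NumberTheory.EllipticCurves.Rank1Residual.Predicates
import Literature.NumberTheory.EllipticCurves.Rank1Residual.PrintShapeTorsion
import HarnessLib

/-!
# BSD rank-≤1 residual cell — class X9 (residually small but irreducible image): typed residue

HONEST FRAMING (cell `b2b-bsdres-*`, verbatim): the goal of the cell is to DELETE the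
COMBINATION-SHAPED residual classes for ALL analytic-rank ≤ 1 curves over ℚ — "full BSD formula
for every rank ≤ 1 curve in class C" assembled STRICTLY from published theorems — so that the
rank-≤1 remainder becomes exactly the CONSTRUCTION-SHAPED classes, which are TYPED (missing-input
Props), NOT attempted; this is not "finishing BSD".

**Class X9** (`RESIDUAL-CASES.md` §a.2 of the bsd-percentage bundle, predicate as simplified by
the literature seat's remark F1; census row `T-BCS` of `bsdN/HYPOTHESES.md`): a NON-CM curve
`E/ℚ` and a prime `p ≥ 5` of GOOD ORDINARY reduction at which `E[p]` is IRREDUCIBLE but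
`ρ̄_{E,p}` is NOT SURJECTIVE (image in the normaliser of a split / non-split Cartan subgroup, or of
projective type `𝔖₄`; `𝔄₄`, `𝔄₅` do not occur over `ℚ`).  The census's only instance with
`N < 10⁴` is `2268b1 @ 5` (`r = 0`, `Ш_an = 1`, image `5S4` in Sutherland's notation).  The class
was labelled COMBINATION-SHAPED ("weakest of the four, confidence LOW") on the strength of
Burungale–Castella–Skinner, IMRN 2025, Cor. 1.3.1 — the `p`-part of BSD in analytic rank `≤ 1` at
a good ordinary `p > 3` under (irr_ℚ) and

> (im) there exists an element `σ ∈ G_{ℚ(μ_{p^∞})}` such that `T/(σ - 1)T ≃ ℤ_p`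

— with the hope that (im) could be DISCHARGED by group theory for some exceptional image types.

**Verdict of this cell (X9 prover, 2026-08-18), kernel-checked:** it cannot, for ANY type.
`Literature.NumberTheory.EllipticCurves.TateModuleTransvectionCriterionProofs`
(`WeierstrassCurve.not_exists_galoisRepTate_quotient_equiv`, axioms standard) proves that for
`E[p]` irreducible and `ρ̄_{E,p}` non-surjective NO `σ ∈ G_{ℚ(μ_{p^∞})}` has
`T_pE/(σ-1)T_pE ≅ ℤ_p` (such a `σ` acts on `E[p]` by a transvection of order `p`; Serre 1972
Prop. 15 then forces the image to be Borel or all of `GL₂(𝔽_p)`).  Hence on X9 the hypothesis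
(im) of BCS Thm. 1.1.2 (b) / Cor. 1.3.1 — which is Kato's (12.5.2)/Thm. 13.4 (3) hypothesis behind
the INTEGRAL divisibility `(L_p) ⊆ ch_Λ X` (BCS p. 10: "(5.4) in `Λ` if hypothesis (im) holds, and
in `Λ ⊗ ℚ_p` otherwise"), Skinner 2016 §2.5 (b), and (as `Γ → Aut T_pE` onto) Howard 2004 Thm. B
for the anticyclotomic side — is violated by every Galois element: it is STRUCTURAL, not a
hypothesis of convenience.  In print on X9 pairs there remain: BCS Thm. 1.1.2 (a) (equality in
`Λ ⊗ ℚ_p`, tree fact `burungale_castella_skinner_charIdeal_eq_padicLFunction`), Kato 17.4 (2),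
and the per-curve Heegner-index bounds (Cha 2005 / Lawson–Wuthrich 2016); Wuthrich 2014 Prop. 21
excludes exactly these primes.  So X9 is re-typed here as a CONSTRUCTION-SHAPED residue whose
missing input is the integral main conjecture at a prime `p ∤ #ρ̄_{E,p}(Γ_ℚ)` — equivalently,
given BCS (a) + Greenberg's control theorem + Mazur–Swinnerton-Dyer interpolation, the `μ`-invariant
comparison `μ(X_ord(E/ℚ_∞)) = μ(L_p(E))` — announced for residually dihedral `p` in
Burungale–Skinner [BS24] (not out; NOT cited as a fact).

Contents (definitions of the cell's typed vocabulary + the deciding negative theorem):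
* `ClassX9 W p` — the class predicate, exactly as in the census (¬cm ∧ p ≥ 5 ∧ good ∧ ordinary ∧
  irr ∧ ¬surj);
* `PPartBSD W p` — "the `p`-part of the BSD formula for `E`" in the currency of the tree's bsd.S30
  / `LeadingTermPPartRankLeOne` (`L^{(r)}(E,1)/(r!·Reg·Ω_E) = q ∈ ℚ` with
  `ord_p q = ord_p(#Ш · ∏ c_ℓ / #E(ℚ)²_tors)`);
* `BCSHypothesisIm W p` — hypothesis (im), literally, on the tree's Tate module;
* `not_bcsHypothesisIm_of_classX9` — **X9 ⟹ ¬(im)** (the deciding negative theorem);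
* `BSDpOnClassX9` — the class statement `∀ E, r_an(E) ≤ 1 ∧ X9(E,p) → BSD_p(E)` as a TYPED
  TARGET (`def … : Prop`; open; no published theorem reaches it);
* `IntegralMainConjectureOnClassX9` — the MISSING INPUT (rank-0 engine), typed: the integral
  cyclotomic main conjecture `ch_Λ X(E/ℚ_∞) = (L_p(E))` in `Λ` on class X9, binder for binder the
  conclusion of BCS Thm. 1.1.2 (b) with (im) replaced by ¬surj.  The rank-1 engine (BCS Thm.
  1.2.4 (b): the BDP anticyclotomic main conjecture integrally, printed under (sur)) is recorded in
  prose only — TODO(typed form) once `L_p^{BDP}` has tree vocabulary.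

Published sources located (pages of the arXiv versions held in the literature store):
BCS arXiv:2405.00270v2 p. 2 L22 (im), p. 3 L27 (sur), Rem. 1.1.3 (iii), Rem. 1.2.3, p. 4 Cor. 1.3.1,
p. 8 Thm. 4.2.1 ("if (sur) holds, then both divisibilities hold integrally … [How04, Thm. B]"),
p. 10 proof of Thm. 1.1.2 ((5.4) via [Kat04, Thm. 17.4]); Skinner, Pacific J. Math. 283 (2016) =
arXiv:1407.1093 p. 11 L24–46 ((a) irreducible + (b) `g ∈ Gal(ℚ̄/ℚ[μ_{p^∞}])` with
`T_f/(ρ_f(g)-1)T_f` free of rank one replace "image contains `SL₂(ℤ_p)`"; (b) ⟹ Kato Thm. 13.4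
(3)); Kato, Astérisque 295 (2004): Thm. 13.4 (v) and (3), (12.5.2) ("the image of
`Gal(ℚ̄/ℚ(ζ_{p^∞})) → GL₂(O_λ)` contains `SL₂(ℤ_p)`"), Thm. 17.4 (3); Howard, Compositio 140
(2004), Thm. B hypotheses ("`Gal(K̄/K) → Aut_{ℤ_p}(T)` is surjective", tree `HowardHypotheses`).
-/

-- the summit and its single problem are both named `BirchSwinnertonDyer` (registry layout D-0017)
set_option linter.dupNamespace false

noncomputable section

open scoped Classical

open WeierstrassCurve Field
open Literature.NumberTheory.EllipticCurves

namespace Summit.BirchSwinnertonDyer.BirchSwinnertonDyer.Rank1Residual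

/-! ### The class predicate and the `p`-part currency -/

/-- **Class X9** of the BSD rank-≤1 residual census (`RESIDUAL-CASES.md` §a.2; `HYPOTHESES.md`
row `T-BCS` complement): `E = W/ℚ` non-CM, `p ≥ 5` a prime of good ordinary reduction
(`p ∤ a_p`), `E[p]` irreducible, `ρ̄_{E,p} : Γ_ℚ → Aut(E[p])` NOT surjective.  (The census's
extra clauses ¬(ram), ¬(im), ¬zhang are automatic: (ram) and (im) each force surjectivity under
(irr) — `not_bcsHypothesisIm_of_classX9` below for (im).) [folklore] -/
def ClassX9 (W : WeierstrassCurve ℚ) [W.IsElliptic] [W.IsGloballyMinimal] (p : ℕ) [Fact p.Prime] :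
    Prop :=
  ¬ W.HasCM ∧ 5 ≤ p ∧ W.HasGoodReductionAtPrime p ∧ ¬ (p : ℤ) ∣ W.frobeniusTrace p ∧
    W.HasIrreducibleModPGaloisRep p ∧ ¬ W.HasSurjectiveModNGaloisRep p

/-- **`BSD_p(E)` in analytic rank `≤ 1`** — the `p`-part of the Birch–Swinnerton-Dyer formula for
a globally minimal `W`, in the currency of the tree's bsd.S30 (`padicValRat_bsd_rank_zero`) and of
`JetchevSkinnerWan2017_padicValRat_bsd_rank_one_ordinary`: the BSD quotient
`L^{(r)}(E,1)/(r! · Reg(E) · Ω_E)` (`W.leadingLCoeff / (W.regulator · W.realPeriodRat)`;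
`Reg = 1` in rank `0`) is a rational number `q` with
`ord_p q = ord_p #Ш(E) + ord_p ∏_ℓ c_ℓ − 2 ord_p #E(ℚ)_tors`.  Meaningful when `Ш(E)` is finite
(then `W.shaOrder` is its order), which is a theorem in analytic rank `≤ 1` (bsd.S17).
[folklore] -/
def PPartBSD (W : WeierstrassCurve ℚ) [W.IsElliptic] [W.IsGloballyMinimal] (p : ℕ)
    [Fact p.Prime] : Prop :=
  ∃ q : ℚ, W.leadingLCoeff / ((W.regulator : ℂ) * (W.realPeriodRat : ℂ)) = (q : ℂ) ∧
    padicValRat p q = (padicValNat p W.shaOrder : ℤ) + padicValNat p W.tamagawaProduct -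
      2 * padicValNat p W.torsionOrder

/-! ### Hypothesis (im), literally, and its failure on class X9 -/

/-- **Hypothesis (im)** of Burungale–Castella–Skinner, IMRN 2025 (rnaf082) = arXiv:2405.00270v2,
p. 2 (hypothesis of Thm. 1.1.2 (b) and Cor. 1.3.1), verbatim: "there exists an element
`σ ∈ G_{ℚ(μ_{p^∞})}` such that `T/(σ - 1)T ≃ ℤ_p`", `T` the `p`-adic Tate module of `E`
(= Kato, Astérisque 295, Thm. 13.4 (3): "`Coker(1 - σ : T → T)` is a free `O_L`-module of rank 1";
Skinner 2016, §2.5 (b); Mazur–Rubin's Kolyvagin-system hypothesis).  Transcription: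
`σ ∈ Γ_ℚ = Gal(ℚ̄/ℚ)` fixes every `p`-power root of unity of `ℚ̄`, and the quotient of
`T_pE = W.tateModule p` by the image of `ρ_{E,p}(σ) - 1` (`W.galoisRepTate p σ - 1`) is
`ℤ_p`-linearly isomorphic to `ℤ_p`.  A PREDICATE on `(E, p)` (not a fact).
[cite: BurungaleCastellaSkinner2025, hypothesis (im) (p. 2)] -/
def BCSHypothesisIm (W : WeierstrassCurve ℚ) (p : ℕ) [Fact p.Prime] : Prop :=
  ∃ σ : absoluteGaloisGroup ℚ,
    (∀ (n : ℕ) (t : AlgebraicClosure ℚ), t ^ p ^ n = 1 → σ • t = t) ∧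
      Nonempty (((W.tateModule p) ⧸ LinearMap.range (W.galoisRepTate p σ - 1)) ≃ₗ[ℤ_[p]] ℤ_[p])

/-- **X9 ⟹ ¬(im): the deciding negative theorem of the X9 analysis.**  On class X9 — indeed as
soon as `E[p]` is irreducible and `ρ̄_{E,p}` is not surjective, for any prime `p` and with no
reduction or CM hypothesis — hypothesis (im) of Burungale–Castella–Skinner 2025 fails: no Galois
element fixing `μ_{p^∞}` has `T_pE/(σ-1)T_pE ≅ ℤ_p`.  Consequently BCS Thm. 1.1.2 (b) and Cor.
1.3.1, Kato's Thm. 17.4 (3), Skinner 2016 Thm. C (via its footnote (b)) and Howard 2004 Thm. B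
have an UNSATISFIABLE hypothesis on every X9 pair, for every exceptional image type alike; no
`bsd_p_of_X9_<type>` can be assembled from them.  Proof:
`WeierstrassCurve.not_exists_galoisRepTate_quotient_equiv` (reduction mod `p` + Serre's Prop. 15;
`TateModuleTransvectionCriterionProofs`, `ModPImageTransvectionCriterionProofs`,
`GaloisRepresentations/TransvectionCriterionGL2FpProofs`). [folklore] -/
theorem not_bcsHypothesisIm_of_irreducible_of_not_surjective (W : WeierstrassCurve ℚ)
    [W.IsElliptic] (p : ℕ) [Fact p.Prime] (hirr : W.HasIrreducibleModPGaloisRep p)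
    (hns : ¬ W.HasSurjectiveModNGaloisRep p) : ¬ BCSHypothesisIm W p :=
  W.not_exists_galoisRepTate_quotient_equiv p hirr hns

/-- **X9 ⟹ ¬(im)** (class form of `not_bcsHypothesisIm_of_irreducible_of_not_surjective`).
[folklore] -/
theorem not_bcsHypothesisIm_of_classX9 (W : WeierstrassCurve ℚ) [W.IsElliptic] [W.IsGloballyMinimal]
    (p : ℕ) [Fact p.Prime] (hX9 : ClassX9 W p) : ¬ BCSHypothesisIm W p :=
  not_bcsHypothesisIm_of_irreducible_of_not_surjective W p hX9.2.2.2.2.1 hX9.2.2.2.2.2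

/-! ### The typed target and the typed missing input -/

/-- **TYPED TARGET — the class theorem for X9 (OPEN; construction-shaped).**  "For every
elliptic curve `E/ℚ` (globally minimal `W`) of analytic rank `≤ 1` and every prime `p` with
`ClassX9(E, p)`, the `p`-part of the BSD formula holds."  No published theorem proves it: every
printed equality of characteristic ideals in `Λ` (rather than `Λ ⊗ ℚ_p`) at a good ordinary
prime passes through hypothesis (im) / big image (`not_bcsHypothesisIm_of_classX9`), and the
announced treatment of residually dihedral primes (Burungale–Skinner [BS24]) is not available.
BSD predicts it; stated as a `Prop`, never asserted.  `Finite W.sha` is carried as in bsd.S30 (a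
theorem in analytic rank `≤ 1`, bsd.S17 `rank_eq_analyticRank_of_analyticRank_le_one`).
[folklore] -/
@[conjecture] def BSDpOnClassX9 : Prop :=
  ∀ (W : WeierstrassCurve ℚ) [W.IsElliptic] [W.IsGloballyMinimal] (p : ℕ) [Fact p.Prime],
    W.analyticRank ≤ 1 → ClassX9 W p → Finite W.sha → PPartBSD W p

/-- **TYPED MISSING INPUT for class X9, rank-`0` engine (OPEN): the INTEGRAL cyclotomic main
conjecture at a good ordinary prime of irreducible, non-surjective image.**  Binder for binder the
tree fact `burungale_castella_skinner_charIdeal_eq_padicLFunction` (BCS Thm. 1.1.2 (a): torsion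
and `ch_Λ X = (L_p)` in `Λ ⊗ ℚ_p`, i.e. `ι g = p^k · L_p(f, α)` for some `k ∈ ℤ`) with the extra
hypothesis `¬ W.HasSurjectiveModNGaloisRep p` and the STRONGER conclusion `k = 0`:
`ch_Λ X(E/ℚ_∞) = Λ g` with `ι g = padicLFunction f α` on the nose — the conclusion of BCS Thm.
1.1.2 (b), printed only under (im) (false here), equivalently of clause 3 of bsd.S21
(`skinner_urban_main_conjecture`, printed under `p`-adic surjectivity).  Given BCS (a), Greenberg's
control theorem (LNM 1716, Thm. 4.1) and the Mazur–Swinnerton-Dyer interpolation, this is what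
`BSDpOnClassX9` needs in rank `0` (the exponent `k = μ(X) − μ(L_p)` is exactly the defect in the
`p`-part), and it is what the announced [BS24] would supply at residually dihedral `p`.  The
normalisation of `L_p` by `Ω⁺_f` rather than `Ω_E` is immaterial under (irr)
(`ord_p(Ω⁺_f/Ω_E) = 0`, Greenberg–Vatsal 2000 §3, as in `LeadingTermPPartProofs`).  The rank-`1`
engine — BCS Thm. 1.2.4 (b): `ch(X^Gr(E/K⁻_∞)) = (L_p^{BDP}(E/K))` in `Λ⁻_K^{ur}`, printed under
(sur) — has no tree vocabulary yet.
-- TODO(typed form): the rank-1 engine (BDP anticyclotomic main conjecture, integrally, without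
-- (sur)) once `L_p^{BDP}` and the anticyclotomic Greenberg Selmer group are in the tree.
[folklore] -/
@[conjecture] def IntegralMainConjectureOnClassX9 : Prop :=
  ∀ (W : WeierstrassCurve ℚ) [W.IsElliptic] [W.IsGloballyMinimal] (p : ℕ) [Fact p.Prime]
    (κ : Literature.NumberTheory.EllipticCurves.ZpExtension ℚ p) (γ : absoluteGaloisGroup ℚ)
    {N : ℕ} [NeZero N] (f : CuspForm (CongruenceSubgroup.Gamma0 N) 2)
    (_hX9 : ClassX9 W p) (_hκ : κ.IsCyclotomic) (_hγ : κ.IsTopGenerator γ)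
    (_hγ' : Literature.NumberTheory.EllipticCurves.IsCyclotomicVariable p γ)
    (_hf : Literature.NumberTheory.EllipticCurves.ModularForms.IsNewformOf W f)
    (D : W.SelmerDualData κ γ),
    D.IsTorsion ∧
      ∃ g : Literature.NumberTheory.EllipticCurves.IwasawaAlgebra p,
        D.charIdeal = Ideal.span {g} ∧
          Literature.NumberTheory.EllipticCurves.iwasawaToPowerSeries p g =
            Literature.NumberTheory.EllipticCurves.padicLFunction f
              (Literature.NumberTheory.EllipticCurves.unitRoot W p : ℚ_[p])

/-- The typed missing input refines the published `Λ ⊗ ℚ_p` statement: on class X9,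
`IntegralMainConjectureOnClassX9` gives the conclusion of BCS Thm. 1.1.2 (a)
(`burungale_castella_skinner_charIdeal_eq_padicLFunction`'s shape) with exponent `k = 0`.
[folklore] -/
theorem exists_int_of_integralMainConjectureOnClassX9 (h : IntegralMainConjectureOnClassX9)
    (W : WeierstrassCurve ℚ) [W.IsElliptic] [W.IsGloballyMinimal] (p : ℕ) [Fact p.Prime]
    (κ : Literature.NumberTheory.EllipticCurves.ZpExtension ℚ p) (γ : absoluteGaloisGroup ℚ)
    {N : ℕ} [NeZero N] (f : CuspForm (CongruenceSubgroup.Gamma0 N) 2)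
    (hX9 : ClassX9 W p) (hκ : κ.IsCyclotomic) (hγ : κ.IsTopGenerator γ)
    (hγ' : Literature.NumberTheory.EllipticCurves.IsCyclotomicVariable p γ)
    (hf : Literature.NumberTheory.EllipticCurves.ModularForms.IsNewformOf W f)
    (D : W.SelmerDualData κ γ) :
    D.IsTorsion ∧
      ∃ (g : Literature.NumberTheory.EllipticCurves.IwasawaAlgebra p) (k : ℤ),
        D.charIdeal = Ideal.span {g} ∧
          Literature.NumberTheory.EllipticCurves.iwasawaToPowerSeries p g =
            PowerSeries.C ((p : ℚ_[p]) ^ k) *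
              Literature.NumberTheory.EllipticCurves.padicLFunction f
                (Literature.NumberTheory.EllipticCurves.unitRoot W p : ℚ_[p]) := by
  obtain ⟨htors, g, hg, hι⟩ := h W p κ γ f hX9 hκ hγ hγ' hf D
  exact ⟨htors, g, 0, hg, by rw [hι, zpow_zero, map_one, one_mul]⟩


/-! ### Bridges to the cell's Literature vocabulary (`Rank1Residual/Predicates.lean`, `PrintShapeTorsion.lean`)

Appended 2026-08-18 (same seat): the literature seat's predicate file landed the census-exact
`Rank1Residual.ClassX9` (with the extra rank-one clause `r = 1 → ¬semistable`, keeping JSW-covered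
pairs out), `Rank1Residual.BigIm` (hypothesis (im), literally) and the print shape
`Rank1Residual.PPart` with its bridge `bsdp_of_pPart` to Miller's `BSDp`.  The definitions above
agree with them: -/

/-- The census-exact class predicate of `Rank1Residual/Predicates.lean` implies this file's
`ClassX9` (which omits the rank-one clause `r = 1 → ¬semistable`). [folklore] -/
theorem classX9_of_classX9_census (W : WeierstrassCurve ℚ) [W.IsElliptic] [W.IsGloballyMinimal]
    (p : ℕ) [Fact p.Prime]
    (h : Literature.NumberTheory.EllipticCurves.Rank1Residual.ClassX9 W p) : ClassX9 W p :=
  ⟨h.1, h.2.2.1, h.2.1.1, h.2.1.2, h.2.2.2.1, h.2.2.2.2.1⟩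

/-- `BCSHypothesisIm` is the literature seat's `BigIm` (hypothesis (im) of
Burungale–Castella–Skinner 2025): the two transcriptions differ only by `σ • t` versus
`toAlgEquiv ℚ σ t` (definitionally equal) and `ρ(σ) - 1` versus `ρ(σ) - LinearMap.id`.
[folklore] -/
theorem bcsHypothesisIm_iff_bigIm (W : WeierstrassCurve ℚ) (p : ℕ) [Fact p.Prime] :
    BCSHypothesisIm W p ↔ Literature.NumberTheory.EllipticCurves.Rank1Residual.BigIm W p := by
  constructor
  · rintro ⟨σ, hσ, h⟩
    refine ⟨σ, fun t n ht => ?_, by simpa only [Module.End.one_eq_id] using h⟩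
    rw [← absoluteGaloisGroup.smul_def]
    exact hσ n t ht
  · rintro ⟨σ, hσ, h⟩
    refine ⟨σ, fun n t ht => ?_, by simpa only [Module.End.one_eq_id] using h⟩
    rw [absoluteGaloisGroup.smul_def]
    exact hσ t n ht

/-- `PPartBSD` is the literature seat's print shape `PPart` (the BSD quotient written with
denominator `Reg · Ω_E` here, `(Ω_E · Reg : ℝ)` there). [folklore] -/
theorem pPartBSD_iff_pPart (W : WeierstrassCurve ℚ) [W.IsElliptic] [W.IsGloballyMinimal] (p : ℕ)
    [Fact p.Prime] :
    PPartBSD W p ↔ Literature.NumberTheory.EllipticCurves.Rank1Residual.PPart W p := by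
  have hden : ((W.regulator : ℂ) * (W.realPeriodRat : ℂ)) =
      ((W.realPeriodRat * W.regulator : ℝ) : ℂ) := by
    push_cast
    ring
  unfold PPartBSD Literature.NumberTheory.EllipticCurves.Rank1Residual.PPart
  rw [hden]

/-- **The typed target in the cell's canonical shape.**  `BSDpOnClassX9` (this file's typed class
statement, print shape) implies the cell's canonical class statement
`∀ W p, r_an(W) ≤ 1 → Rank1Residual.ClassX9 W p → BSDp W p` (Miller's `BSD(E,p)`), by the
literature seat's bridge `bsdp_of_pPart` — granted Gross–Zagier–Kolyvagin (`hGZK`, bsd.S17) and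
the entire continuation of `L(E,s)` (`hmod`), both published and both already hypotheses of that
bridge.  Bookkeeping only: no class is claimed closed (`BSDpOnClassX9` is open). [folklore] -/
theorem bsdp_of_bsdpOnClassX9
    (hmod : WeierstrassCurve.hasEntireLFunction_rat)
    (hGZK : Literature.NumberTheory.EllipticCurves.rank_eq_analyticRank_of_analyticRank_le_one)
    (h : BSDpOnClassX9) (W : WeierstrassCurve ℚ) [W.IsElliptic] [W.IsGloballyMinimal] (p : ℕ)
    [Fact p.Prime] (hr : W.analyticRank ≤ 1)
    (hX9 : Literature.NumberTheory.EllipticCurves.Rank1Residual.ClassX9 W p) :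
    Literature.NumberTheory.EllipticCurves.BSDp W p := by
  have hfin : Finite W.sha := (hGZK W hr).2
  exact Literature.NumberTheory.EllipticCurves.Rank1Residual.bsdp_of_pPart W p hmod hGZK hr
    ((pPartBSD_iff_pPart W p).mp (h W p hr (classX9_of_classX9_census W p hX9) hfin))

end Summit.BirchSwinnertonDyer.BirchSwinnertonDyer.Rank1Residual
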